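import Summits.CriticalPhenomena.PercolationContinuityZ3.Theorems.PercNearOneGluingNoHeavyLowerTailSahiCubeThreeAllOrders
import Mathlib.Data.Fintype.Perm
import HarnessLib

/-!
# `∩`-closed families in an FKG lattice: antichain reduction; two generators ⇒ every order; three generators ⟺ one cubic

Support file for the Sahi programme (`--supports stmt-CriticalPhenomena-4575`, prover prim-sahi-p2 gen 10).  No definitions, no named facts, no
sorries; standard axioms.  Lattice companion of `…SahiPrincipalAntichain` (product weights / percolation), for the use of the lattice seats.

Let `μ` be an FKG probability weight on a finite distributive lattice `α` and `A : Finset β → Finset α` an `∩`-CLOSED family of up-sets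
(`A (T ∪ T') = A T ∩ A T'`; e.g. `A T = ⋂_{j ∈ T} U_j` for up-sets `U_j`, `A ∅ = ⊤`).
* `sahiE_setInd_nonneg_of_antichains_fkg`: if the ANTICHAIN sub-families (`T_i ⊄ T_j`) of size `k ≥ 3` have `E_k ≥ 0`, every family has `E_n ≥ 0`
  at every order (nested pair ⇒ absorbed slot, prim-sahi-p1's peel `SahiCubeAllOrders.sahiE_setInd_nonneg_of_nested` mechanism run INSIDE the subfamily;
  order `2` = FKG).
* `sahiE_setInd_nonneg_of_twoGenerators_fkg`: the lattice `{U, V, U ∩ V, …}` generated by TWO up-sets is Sahi-positive at every order — for every FKG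
  weight, unconditionally (Sahi's Prop. 15 [Sahi2008, p. 222] is the case `α = 2^{2}`, `U, V` the two principal up-sets).
* `sahiE_setInd_threeGenerators_iff_fkg`: for THREE up-sets `U₀, U₁, U₂`, every family drawn from the `∩`-closed family they generate is Sahi-positive
  at every order **iff** `E₃(χ_{U₀}, χ_{U₁}, χ_{U₂}) ≥ 0` (the only other antichain, the three pairwise intersections, is a Δ-system whose `E₃` equals
  `(x−d)yz + d((1−y)(1−z) + (1−x)) ≥ 0` identically).  Compare prim-masterthm's `SahiDeltaSystem.sahiPositive_m3_iff` (the five-point lattice `M₃`).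
-/

namespace Summit.CriticalPhenomena.PercolationContinuityZ3.Theorems

namespace SahiAntichainFKG

open Finset Function Literature.Combinatorics.Sahi2008
open scoped Classical

variable {α β : Type*} [Fintype α] [DecidableEq α] [DistribLattice α] [DecidableEq β]

/-- **Antichain reduction inside an `∩`-closed family of up-sets, any FKG weight.** [this work] -/
theorem sahiE_setInd_nonneg_of_antichains_fkg {μ : α → ℝ} (hμ : IsFKGMeasure μ) (A : Finset β → Finset α)
    (hA : ∀ T T' : Finset β, A (T ∪ T') = A T ∩ A T') (hup : ∀ T, IsUpperSet ((A T : Finset α) : Set α))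
    (H : ∀ (k : ℕ) (T : Fin (k + 3) → Finset β), (Pairwise fun i j => ¬ T i ⊆ T j) →
      0 ≤ sahiE μ (k + 3) (fun i => setInd (A (T i)))) :
    ∀ (n : ℕ) (T : Fin n → Finset β), 0 ≤ sahiE μ n (fun i => setInd (A (T i))) := by
  have habsorb : ∀ {T T' : Finset β}, T ⊆ T' → setInd (A T') * setInd (A T) = setInd (A T') := by
    intro T T' h
    rw [setInd_mul, ← hA, Finset.union_eq_left.2 h]
  intro n
  induction n with
  | zero => intro T; rw [sahiE_zero]
  | succ n ih =>
    intro T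
    match n, ih with
    | 0, _ =>
      rw [sahiE_one_apply]
      exact ex_nonneg hμ.nonneg fun x => setInd_nonneg _ _
    | 1, _ =>
      exact sahiPositive_two hμ _ (fun i x => setInd_nonneg _ _) (fun i => monotone_setInd (hup _))
    | m + 2, ih =>
      by_cases hanti : Pairwise fun i j => ¬ T i ⊆ T j
      · exact H m T hanti
      · unfold Pairwise at hanti
        push Not at hanti
        obtain ⟨i, j, hij, hsub⟩ := hanti
        obtain ⟨σ, hσ⟩ : ∃ σ : Equiv.Perm (Fin (m + 3)), σ = Equiv.swap 0 i := ⟨_, rfl⟩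
        have hσ0 : σ 0 = i := by rw [hσ, Equiv.swap_apply_left]
        have hfam : (fun k => setInd (A (T (σ k)))) =
            Matrix.vecCons (setInd (A (T i))) (fun k : Fin (m + 2) => setInd (A (T (σ k.succ)))) := by
          funext k
          refine Fin.cases ?_ (fun k' => ?_) k
          · simp only [Matrix.cons_val_zero, hσ0]
          · simp only [Matrix.cons_val_succ]
        rw [← sahiE_comp_perm μ (m + 3) σ (fun k => setInd (A (T k))), hfam]
        refine sahiE_cons_nonneg_of_absorbed ?_ ?_ ?_ ?_
        · calc ex μ (setInd (A (T i))) ≤ ex μ (fun _ => (1 : ℝ)) :=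
                ex_mono hμ.nonneg fun x => by rw [setInd_apply]; split_ifs <;> norm_num
            _ = 1 := ex_const hμ.sum_eq_one 1
        · have hj0 : σ.symm j ≠ 0 := by
            intro h0
            apply hij
            rw [← hσ0, ← h0, Equiv.apply_symm_apply]
          obtain ⟨k₀, hk₀⟩ := Fin.exists_succ_eq.2 hj0
          refine ⟨k₀, ?_⟩
          have hσk : σ k₀.succ = j := by rw [hk₀, Equiv.apply_symm_apply]
          show setInd (A (T (σ k₀.succ))) * setInd (A (T i)) = setInd (A (T (σ k₀.succ)))
          rw [hσk]
          exact habsorb hsub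
        · exact ih (fun k => T (σ k.succ))
        · intro k
          have hupd : Function.update (fun k' : Fin (m + 2) => setInd (A (T (σ k'.succ)))) k
              (setInd (A (T (σ k.succ))) * setInd (A (T i))) =
              fun k' => setInd (A (Function.update (fun k' : Fin (m + 2) => T (σ k'.succ)) k (T (σ k.succ) ∪ T i) k')) := by
            funext k'
            by_cases hk : k' = k
            · subst hk
              simp only [Function.update_self, setInd_mul, hA]
            · simp only [Function.update_of_ne hk]
          rw [hupd]
          exact ih _

/-- Three subsets of `Fin 2` contain a nested pair (kernel check). [folklore] -/
private theorem nested_of_three_fin_two : ∀ S₀ S₁ S₂ : Finset (Fin 2),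
    S₀ ⊆ S₁ ∨ S₀ ⊆ S₂ ∨ S₁ ⊆ S₀ ∨ S₁ ⊆ S₂ ∨ S₂ ⊆ S₀ ∨ S₂ ⊆ S₁ := by
  decide

/-- **Two generators: every FKG weight, every order, unconditionally.**  For an `∩`-closed family of up-sets indexed by the subsets of a two-element
set (the lattice generated by two up-sets `U, V`: `A ∅ ⊇ U, V ⊇ U ∩ V`), every family drawn from it has `E_n ≥ 0`.  [this work; Sahi2008 Prop. 15 is `α = 2^2`] -/
theorem sahiE_setInd_nonneg_of_twoGenerators_fkg {μ : α → ℝ} (hμ : IsFKGMeasure μ) (A : Finset (Fin 2) → Finset α)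
    (hA : ∀ T T' : Finset (Fin 2), A (T ∪ T') = A T ∩ A T') (hup : ∀ T, IsUpperSet ((A T : Finset α) : Set α))
    (n : ℕ) (T : Fin n → Finset (Fin 2)) : 0 ≤ sahiE μ n (fun i => setInd (A (T i))) := by
  refine sahiE_setInd_nonneg_of_antichains_fkg hμ A hA hup (fun k T hanti => ?_) n T
  exfalso
  let e : Fin 3 → Fin (k + 3) := Fin.castLE (by omega)
  have he : Function.Injective e := Fin.castLE_injective _
  have ne : ∀ {i j : Fin 3}, i ≠ j → ¬ T (e i) ⊆ T (e j) := fun h => hanti (he.ne h)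
  rcases nested_of_three_fin_two (T (e 0)) (T (e 1)) (T (e 2)) with h | h | h | h | h | h <;>
    first
    | exact ne (by decide) h

/-- The antichains of size `3` in `2^{Fin 3}` (kernel check). [folklore] -/
private theorem antichain_three_structure :
    ∀ S : Fin 3 → Finset (Fin 3), (∀ i j, i ≠ j → ¬ S i ⊆ S j) →
      (∃ σ : Equiv.Perm (Fin 3), ∀ i, S i = {σ i}) ∨
        (∃ σ : Equiv.Perm (Fin 3), ∀ i, S i = Finset.univ.erase (σ i)) := by
  set_option maxRecDepth 100000 in
  decide

/-- Among four subsets of `Fin 3` two are nested (kernel check). [folklore] -/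
private theorem nested_of_four : ∀ S₀ S₁ S₂ S₃ : Finset (Fin 3),
    S₀ ⊆ S₁ ∨ S₀ ⊆ S₂ ∨ S₀ ⊆ S₃ ∨ S₁ ⊆ S₀ ∨ S₁ ⊆ S₂ ∨ S₁ ⊆ S₃ ∨
      S₂ ⊆ S₀ ∨ S₂ ⊆ S₁ ∨ S₂ ⊆ S₃ ∨ S₃ ⊆ S₀ ∨ S₃ ⊆ S₁ ∨ S₃ ⊆ S₂ := by
  set_option maxRecDepth 100000 in
  decide

/-- Two distinct co-points of `Fin 3` cover it (kernel check). [folklore] -/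
private theorem erase_union_erase : ∀ a b : Fin 3, a ≠ b →
    Finset.univ.erase a ∪ Finset.univ.erase b = Finset.univ := by
  decide

/-- Elementary cubic of the Δ-system (plumbing): `0 ≤ d ≤ x`, `0 ≤ y, z`, `x, y, z ≤ 1` give
`2d + xyz − d(x + y + z) = (x − d)yz + d((1 − y)(1 − z) + (1 − x)) ≥ 0`. [folklore] -/
private theorem deltaSystem_cubic_nonneg {d x y z : ℝ} (hd : 0 ≤ d) (hdx : d ≤ x) (hy : 0 ≤ y) (hz : 0 ≤ z)
    (hx1 : x ≤ 1) (hy1 : y ≤ 1) (hz1 : z ≤ 1) :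
    0 ≤ 2 * d + x * y * z - (x * d + y * d + z * d) := by
  have h1 : 0 ≤ (x - d) * y * z := mul_nonneg (mul_nonneg (sub_nonneg.2 hdx) hy) hz
  have h2 : 0 ≤ d * ((1 - y) * (1 - z)) := mul_nonneg hd (mul_nonneg (sub_nonneg.2 hy1) (sub_nonneg.2 hz1))
  have h3 : 0 ≤ d * (1 - x) := mul_nonneg hd (sub_nonneg.2 hx1)
  nlinarith [h1, h2, h3]

omit [DecidableEq β] in
/-- Finite meets of up-sets are up-sets (the empty meet is `⊤ = univ`). [folklore] -/
private theorem isUpperSet_inf (U : Fin 3 → Finset α) (hU : ∀ j, IsUpperSet ((U j : Finset α) : Set α))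
    (S : Finset (Fin 3)) : IsUpperSet ((S.inf U : Finset α) : Set α) := by
  classical
  induction S using Finset.induction_on with
  | empty => rw [Finset.inf_empty, Finset.top_eq_univ, Finset.coe_univ]; exact isUpperSet_univ
  | insert a S ha ih =>
    rw [Finset.inf_insert, Finset.inf_eq_inter, Finset.coe_inter]
    exact (hU a).inter ih

/-- `E(χ_W) ≤ 1` under a probability weight (plumbing). [folklore] -/
private theorem ex_setInd_le_one {μ : α → ℝ} (hμ : IsFKGMeasure μ) (W : Finset α) : ex μ (setInd W) ≤ 1 :=
  calc ex μ (setInd W) ≤ ex μ (fun _ => (1 : ℝ)) :=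
        ex_mono hμ.nonneg fun x => by rw [setInd_apply]; split_ifs <;> norm_num
    _ = 1 := ex_const hμ.sum_eq_one 1

/-- `E(χ_W) ≤ E(χ_{W'})` for `W ⊆ W'` (plumbing). [folklore] -/
private theorem ex_setInd_mono {μ : α → ℝ} (hμ : IsFKGMeasure μ) {W W' : Finset α} (h : W ⊆ W') :
    ex μ (setInd W) ≤ ex μ (setInd W') :=
  ex_mono hμ.nonneg fun x => by
    rw [setInd_apply, setInd_apply]
    by_cases hx : x ∈ W
    · rw [if_pos hx, if_pos (h hx)]
    · rw [if_neg hx]; split_ifs <;> norm_num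

/-- **Three generators ⟺ one cubic, every FKG weight.**  For three up-sets `U₀, U₁, U₂` of a finite distributive lattice with an FKG probability
weight: every family drawn (with repeats) from the `∩`-closed family `{⋂_{j∈S} U_j : S ⊆ {0,1,2}}` they generate (`S.inf U`, the empty meet being
`univ`) has `E_n ≥ 0` for every `n` **iff** `E₃(χ_{U₀}, χ_{U₁}, χ_{U₂}) ≥ 0`. [this work] -/
theorem sahiE_setInd_threeGenerators_iff_fkg {μ : α → ℝ} (hμ : IsFKGMeasure μ) (U : Fin 3 → Finset α)
    (hU : ∀ j, IsUpperSet ((U j : Finset α) : Set α)) :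
    (∀ (n : ℕ) (S : Fin n → Finset (Fin 3)), 0 ≤ sahiE μ n (fun i => setInd ((S i).inf U))) ↔
      0 ≤ sahiE μ 3 (fun j => setInd (U j)) := by
  constructor
  · intro h
    have h3 := h 3 (fun i => {i})
    simp only [Finset.inf_singleton] at h3
    exact h3
  · intro hstar
    refine sahiE_setInd_nonneg_of_antichains_fkg hμ (fun S : Finset (Fin 3) => S.inf U)
      (fun S S' => by rw [Finset.inf_union, Finset.inf_eq_inter]) (isUpperSet_inf U hU) ?_
    intro k T hanti
    cases k with
    | succ k =>
      exfalso
      let e : Fin 4 → Fin (k + 1 + 3) := Fin.castLE (by omega)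
      have he : Function.Injective e := Fin.castLE_injective _
      have ne : ∀ {i j : Fin 4}, i ≠ j → ¬ T (e i) ⊆ T (e j) := fun h => hanti (he.ne h)
      rcases nested_of_four (T (e 0)) (T (e 1)) (T (e 2)) (T (e 3)) with h | h | h | h | h | h | h | h | h | h | h | h <;>
        first
        | exact ne (by decide) h
    | zero =>
      have hanti' : ∀ i j : Fin 3, i ≠ j → ¬ T i ⊆ T j := fun i j h => hanti h
      rcases antichain_three_structure T hanti' with ⟨σ, hσ⟩ | ⟨σ, hσ⟩
      · have hfam : (fun i => setInd ((T i).inf U)) = fun i => (fun j : Fin 3 => setInd (U j)) (σ i) := by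
          funext i; rw [hσ i, Finset.inf_singleton]
        rw [hfam, sahiE_comp_perm μ 3 σ (fun j : Fin 3 => setInd (U j))]
        exact hstar
      · set D : Finset α := (Finset.univ : Finset (Fin 3)).inf U with hD
        set F : Fin 3 → α → ℝ := fun i => setInd ((T i).inf U) with hF
        have hpair : ∀ {i i' : Fin 3}, i ≠ i' → F i * F i' = setInd D := by
          intro i i' hii'
          simp only [hF]
          rw [setInd_mul, ← Finset.inf_eq_inter, ← Finset.inf_union, hσ i, hσ i',
            erase_union_erase (σ i) (σ i') (fun h => hii' (σ.injective h))]
        have hsubD : ∀ i : Fin 3, D ⊆ (T i).inf U := fun i =>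
          Finset.inf_mono (Finset.subset_univ _)
        have htriple : F 0 * F 1 * F 2 = setInd D := by
          rw [hpair (show (0 : Fin 3) ≠ 1 by decide)]
          simp only [hF]
          rw [setInd_mul, Finset.inter_eq_left.2 (hsubD 2)]
        have hx : ∀ i : Fin 3, 0 ≤ ex μ (F i) := fun i => ex_nonneg hμ.nonneg fun x => setInd_nonneg _ _
        have hx1 : ∀ i : Fin 3, ex μ (F i) ≤ 1 := fun i => ex_setInd_le_one hμ _
        have hd : 0 ≤ ex μ (setInd D) := ex_nonneg hμ.nonneg fun x => setInd_nonneg _ _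
        have hdx : ∀ i : Fin 3, ex μ (setInd D) ≤ ex μ (F i) := fun i => ex_setInd_mono hμ (hsubD i)
        show 0 ≤ sahiE μ 3 F
        rw [sahiE_three_apply, htriple, hpair (show (1 : Fin 3) ≠ 2 by decide),
          hpair (show (0 : Fin 3) ≠ 2 by decide), hpair (show (0 : Fin 3) ≠ 1 by decide)]
        have key := deltaSystem_cubic_nonneg hd (hdx 0) (hx 1) (hx 2) (hx1 0) (hx1 1) (hx1 2)
        linarith [key]

end SahiAntichainFKG

end Summit.CriticalPhenomena.PercolationContinuityZ3.Theorems

/-! ### Part 2 (append).  General index semilattices; no three-element antichain ⇒ every order for every FKG weight; a chain of up-sets plus one -/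

namespace Summit.CriticalPhenomena.PercolationContinuityZ3.Theorems

namespace SahiAntichainFKG

open Finset Function Literature.Combinatorics.Sahi2008
open scoped Classical

variable {α L : Type*} [Fintype α] [DecidableEq α] [DistribLattice α] [SemilatticeSup L]

/-- **Antichain reduction for an `⊔`-multiplicative family of up-sets indexed by any semilattice, any FKG weight.** [this work] -/
theorem sahiE_setInd_nonneg_of_antichains_sup_fkg {μ : α → ℝ} (hμ : IsFKGMeasure μ) (A : L → Finset α)
    (hA : ∀ x y : L, A (x ⊔ y) = A x ∩ A y) (hup : ∀ x, IsUpperSet ((A x : Finset α) : Set α))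
    (H : ∀ (k : ℕ) (T : Fin (k + 3) → L), (Pairwise fun i j => ¬ T i ≤ T j) →
      0 ≤ sahiE μ (k + 3) (fun i => setInd (A (T i)))) :
    ∀ (n : ℕ) (T : Fin n → L), 0 ≤ sahiE μ n (fun i => setInd (A (T i))) := by
  have habsorb : ∀ {x y : L}, x ≤ y → setInd (A y) * setInd (A x) = setInd (A y) := by
    intro x y h
    rw [setInd_mul, ← hA, sup_eq_left.2 h]
  intro n
  induction n with
  | zero => intro T; rw [sahiE_zero]
  | succ n ih =>
    intro T
    match n, ih with
    | 0, _ =>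
      rw [sahiE_one_apply]
      exact ex_nonneg hμ.nonneg fun x => setInd_nonneg _ _
    | 1, _ =>
      exact sahiPositive_two hμ _ (fun i x => setInd_nonneg _ _) (fun i => monotone_setInd (hup _))
    | m + 2, ih =>
      by_cases hanti : Pairwise fun i j => ¬ T i ≤ T j
      · exact H m T hanti
      · unfold Pairwise at hanti
        push Not at hanti
        obtain ⟨i, j, hij, hsub⟩ := hanti
        obtain ⟨σ, hσ⟩ : ∃ σ : Equiv.Perm (Fin (m + 3)), σ = Equiv.swap 0 i := ⟨_, rfl⟩
        have hσ0 : σ 0 = i := by rw [hσ, Equiv.swap_apply_left]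
        have hfam : (fun k => setInd (A (T (σ k)))) =
            Matrix.vecCons (setInd (A (T i))) (fun k : Fin (m + 2) => setInd (A (T (σ k.succ)))) := by
          funext k
          refine Fin.cases ?_ (fun k' => ?_) k
          · simp only [Matrix.cons_val_zero, hσ0]
          · simp only [Matrix.cons_val_succ]
        rw [← sahiE_comp_perm μ (m + 3) σ (fun k => setInd (A (T k))), hfam]
        refine sahiE_cons_nonneg_of_absorbed ?_ ?_ ?_ ?_
        · calc ex μ (setInd (A (T i))) ≤ ex μ (fun _ => (1 : ℝ)) :=
                ex_mono hμ.nonneg fun x => by rw [setInd_apply]; split_ifs <;> norm_num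
            _ = 1 := ex_const hμ.sum_eq_one 1
        · have hj0 : σ.symm j ≠ 0 := by
            intro h0
            apply hij
            rw [← hσ0, ← h0, Equiv.apply_symm_apply]
          obtain ⟨k₀, hk₀⟩ := Fin.exists_succ_eq.2 hj0
          refine ⟨k₀, ?_⟩
          have hσk : σ k₀.succ = j := by rw [hk₀, Equiv.apply_symm_apply]
          show setInd (A (T (σ k₀.succ))) * setInd (A (T i)) = setInd (A (T (σ k₀.succ)))
          rw [hσk]
          exact habsorb hsub
        · exact ih (fun k => T (σ k.succ))
        · intro k
          have hupd : Function.update (fun k' : Fin (m + 2) => setInd (A (T (σ k'.succ)))) k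
              (setInd (A (T (σ k.succ))) * setInd (A (T i))) =
              fun k' => setInd (A (Function.update (fun k' : Fin (m + 2) => T (σ k'.succ)) k (T (σ k.succ) ⊔ T i) k')) := by
            funext k'
            by_cases hk : k' = k
            · subst hk
              simp only [Function.update_self, setInd_mul, hA]
            · simp only [Function.update_of_ne hk]
          rw [hupd]
          exact ih _

/-- **No three-element antichain in the index poset ⇒ EVERY order, EVERY FKG weight, unconditionally** (only FKG at order 2 is used). [this work] -/
theorem sahiE_setInd_nonneg_of_noThreeAntichain_fkg {μ : α → ℝ} (hμ : IsFKGMeasure μ) (A : L → Finset α)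
    (hA : ∀ x y : L, A (x ⊔ y) = A x ∩ A y) (hup : ∀ x, IsUpperSet ((A x : Finset α) : Set α))
    (h3 : ∀ x y z : L, x ≤ y ∨ y ≤ x ∨ x ≤ z ∨ z ≤ x ∨ y ≤ z ∨ z ≤ y) :
    ∀ (n : ℕ) (T : Fin n → L), 0 ≤ sahiE μ n (fun i => setInd (A (T i))) := by
  refine sahiE_setInd_nonneg_of_antichains_sup_fkg hμ A hA hup fun k T hanti => ?_
  exfalso
  let e : Fin 3 → Fin (k + 3) := Fin.castLE (by omega)
  have he : Function.Injective e := Fin.castLE_injective _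
  have ne : ∀ {i j : Fin 3}, i ≠ j → ¬ T (e i) ≤ T (e j) := fun h => hanti (he.ne h)
  rcases h3 (T (e 0)) (T (e 1)) (T (e 2)) with h | h | h | h | h | h
  · exact ne (by decide) h
  · exact ne (by decide) h
  · exact ne (by decide) h
  · exact ne (by decide) h
  · exact ne (by decide) h
  · exact ne (by decide) h

omit [Fintype α] [DecidableEq α] [DistribLattice α] [SemilatticeSup L] in
/-- In `Fin m × Bool` any three elements contain a comparable pair. [folklore] -/
private theorem fin_prod_bool_noThreeAntichain {m : ℕ} (x y z : Fin m × Bool) :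
    x ≤ y ∨ y ≤ x ∨ x ≤ z ∨ z ≤ x ∨ y ≤ z ∨ z ≤ y := by
  obtain ⟨i, a⟩ := x
  obtain ⟨j, b⟩ := y
  obtain ⟨l, c⟩ := z
  simp only [Prod.mk_le_mk]
  rcases le_total i j with hij | hij <;> rcases le_total i l with hil | hil <;> rcases le_total j l with hjl | hjl <;>
    cases a <;> cases b <;> cases c <;> simp_all

/-- **A CHAIN of up-sets plus ONE further up-set: every FKG weight, every order, unconditionally.**  Let `C : Fin m → Finset α` be an
ANTItone chain of up-sets (`i ≤ j ⇒ C j ⊆ C i`; put `C 0 = univ` to include `V` alone) and `V` an up-set.  Every family drawn from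
`{C i}` and `{C i ∩ V}` — indexed by `(i, b) : Fin m × Bool` — has `E_n ≥ 0` for every `n` under every FKG probability weight.  Sahi's Prop. 15
(`|X| ≤ 2`) and the tree's 'chain off one point' class are the smallest cases. [this work] -/
theorem sahiE_setInd_chainPlusOne_fkg {μ : α → ℝ} (hμ : IsFKGMeasure μ) {m : ℕ} (C : Fin m → Finset α) (hC : Antitone C)
    (hCup : ∀ i, IsUpperSet ((C i : Finset α) : Set α)) (V : Finset α) (hV : IsUpperSet ((V : Finset α) : Set α))
    (n : ℕ) (S : Fin n → Fin m × Bool) :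
    0 ≤ sahiE μ n (fun i => setInd (C (S i).1 ∩ (if (S i).2 then V else Finset.univ))) := by
  let A : Fin m × Bool → Finset α := fun x => C x.1 ∩ (if x.2 then V else Finset.univ)
  have hA : ∀ x y : Fin m × Bool, A (x ⊔ y) = A x ∩ A y := by
    intro x y
    obtain ⟨i, a⟩ := x
    obtain ⟨j, b⟩ := y
    show C (i ⊔ j) ∩ (if (a ⊔ b) then V else Finset.univ) = (C i ∩ (if a then V else Finset.univ)) ∩ (C j ∩ (if b then V else Finset.univ))
    have hCij : C (i ⊔ j) = C i ∩ C j := by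
      rcases le_total i j with h | h
      · rw [sup_eq_right.2 h, Finset.inter_eq_right.2 (hC h)]
      · rw [sup_eq_left.2 h, Finset.inter_eq_left.2 (hC h)]
    rw [hCij]
    ext x
    cases a <;> cases b <;> simp [Finset.mem_inter, and_comm, and_left_comm]
  have hup : ∀ x, IsUpperSet ((A x : Finset α) : Set α) := by
    intro x
    obtain ⟨i, a⟩ := x
    show IsUpperSet ((C i ∩ (if a then V else Finset.univ) : Finset α) : Set α)
    rw [Finset.coe_inter]
    refine (hCup i).inter ?_
    cases a
    · simp only [Bool.false_eq_true, ↓reduceIte, Finset.coe_univ]; exact isUpperSet_univ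
    · simp only [↓reduceIte]; exact hV
  exact sahiE_setInd_nonneg_of_noThreeAntichain_fkg hμ A hA hup fin_prod_bool_noThreeAntichain n S

end SahiAntichainFKG

end Summit.CriticalPhenomena.PercolationContinuityZ3.Theorems
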